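import Literature.IUT.HodgeArakelov.MonoThetaProjectiveChainProofs
import Literature.IUT.HodgeArakelov.MonoThetaProjectiveNaturalSystemAtModelTate

/-!
# [IUTchII] Prop. 1.5 (i): the frozen `Prop15_i A B` is a SCHEMA — universal-closure certificate by the
# KILLED-TRANSITIONS twin (proof-only; K-L6 input F-0665)

S. Mochizuki, *Inter-universal Teichmüller theory II*, kurims manuscript (Dec. 2020), §1, Prop. 1.5 (i) p. 29:
"Such a projective system is uniquely determined, up to isomorphism, by `X̲̲_k` [cf. Remark 1.5.1 below; the
discrete rigidity property of [EtTh], Corollary 2.19, (ii)]" [claim: Mochizuki2012, status: disputed]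
(IUTchII §1 Prop 1.5 (i), kurims p.29); S. Mochizuki, *The étale theta function …*, Publ. RIMS **45** (2009)
[EtTh], Def. 2.13 (ii) p. 274 (PRIMS PDF p. 48): "we shall refer to as a morphism of mono-theta environments
`M → M'` any isomorphism `M_{N'} ⥲ M'`" [cite: MochizukiEtTh2009, Def 2.13(ii) p.48].
abc-iut cell, D-0079 R-C / L-K (K-L6 slice), seat abc-iut-w6-d014 (gen 6).  PROOF-ONLY companion of
abc-iut-L6-t1's frozen `MonoThetaProjective.lean` (p407497: `Prop15_i`, FACT-LIST row **F-0665**, label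
«model-witness») and of abc-iut-L6-t19's repair file of record `MonoThetaProjectiveR.lean` (`Prop15_i'`,
`IsMonoThetaCompatible`): no `def`, no `instance`, nothing re-typed.

THE DEFECT, as recorded in the header of `MonoThetaProjectiveR.lean` (abc-iut-L6-t23 R-9 / referee lane P):
the frozen `MonoThetaProjSystem` carries its transition maps `trans : Π_{M^Θ_{M'}} → Π_{M^Θ_M}` as BARE continuous
homomorphisms, whereas print's arrows are morphisms of mono-theta environments; "no kernel witness is given
here (it needs the theta sections of a genuine model; docstring pointer only)".  THIS FILE is that kernel
witness, and it needs no theta sections: instead of TWISTING the transitions by Kummer shifts we KILL them.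

* `MonoThetaProjSystem.exists_twin_not_prop15_i` — for ANY system `A` over ANY model family with ONE value
  `A.trans h x ≠ 1` at distinct indices `M ∣ M'`, the system `B` with the SAME mod-`M` mono-theta environments
  `B.env = A.env` and the SAME Def. 1.1 (i) outputs `B.recon = A.recon` at every level, but every off-diagonal
  transition `:= 1` (the trivial homomorphism; functoriality, continuity and the compatibility with
  `Π_M ↠ Π_Y ⊆ Π_X` hold trivially), satisfies `¬ Prop15_i A B ∧ ¬ Prop15_i B A`: a compatible family of
  isomorphisms `e_M` would give `e_M (A.trans h x) = B.trans h (e_{M'} x) = 1`.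
* `MonoThetaProjSystem.exists_extCyc_ne_one` — at every level `M ≥ 2` the exterior cyclotome
  `Π_μ(M^Θ_M) ≅ (ℤ/Mℤ)(1)` (`Reconstruction.ext_iso_ZMod`, `(F.setting M).N = M`) has a non-trivial element, so
  `…_of_surjective`: every system with SURJECTIVE transitions has such a twin (indices `2 ∣ 4`), and
  `…_of_isMonoThetaCompatible`: so does every system OF MONO-THETA ENVIRONMENTS in the repaired sense
  (`IsMonoThetaCompatible R`, transitions surjective by abc-iut-w4-d030's
  `trans_surjective_of_isMonoThetaCompatible`); the twin is NOT `R`-compatible, so the repaired `Prop15_i' R`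
  holds for the pair (vacuously, `prop15_i'_of_not_compatible`) — the repair is immune, as its header says.
* `exists_isMonoThetaCompatible_twin_not_prop15_i`, **`not_forall_prop15_i`** — the CLOSED certificate at
  universe `0`: abc-iut-w5-d233's census `ThetaSetting.exists_isEtThOrigin_sec2Hyps_naturalSystem_of_dvd_pred`
  (the NATURAL projective system of the Tate curve AT THE TATE MODEL, `p = 13`, `l = 3`, chain
  `EtaleLevels.chainSet 1 1`, `IsMonoThetaCompatible` with NO `Prop` binder) supplies a compatible system, whence
  `¬ ∀ (S : ThetaSetting.{0}) (F : ModelFamily S) (A B : MonoThetaProjSystem F), Prop15_i A B`.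

FACT-LIST currency (row F-0665 `Prop15_i`, K-L6 input of cone row IUTchII:Prop1.5(i)): «universal closure
REFUTED / schema»; the instance forms the cone consumes are `prop15_i_refl` (abc-iut-w4-d030),
`EtaleLevels.prop15_i_modelSystem_modelχ` (abc-iut-f-150), the second conjunct of abc-iut-w5-d233's
`ModelTateCarriers.prop15_i_i'_ii_iii_modelSystem_modelTate`, and the repaired `Prop15_i'` (BY NAME).

HONEST FRAMING: a refuted universal closure is a statement about OUR typing (the frozen interface admits
degenerate transition data between genuine environments), not about print's Prop. 1.5 (i), whose projective
systems have morphisms of mono-theta environments as arrows (that reading is `Prop15_i'`, untouched here);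
the [IUTchII] claim key `Mochizuki2012` is DISPUTED (D-0012) and nothing of it is asserted; no side is taken on
[IUTchIII] Cor. 3.12; typed ≠ proved; nothing here asserts abc proved or refuted.
-/

namespace Literature.IUT.HodgeArakelov

universe u

variable {S : ThetaSetting.{u}} {F : ModelFamily S}

namespace MonoThetaProjSystem

/-- Bookkeeping in `(ℕ_{≥1}, ∣)`: `M ∣ M' ∣ M''` with `M = M''` forces `M = M'` (divisibility of positive
integers is antisymmetric). [cite: Mochizuki2012, Prop 1.5 (i) p.29] -/
theorem pnat_eq_of_dvd_of_dvd_of_eq {M M' M'' : ℕ+} (h : (M : ℕ) ∣ (M' : ℕ)) (h' : (M' : ℕ) ∣ (M'' : ℕ))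
    (hM : M = M'') : M = M' := by
  subst hM
  exact PNat.coe_inj.1 (le_antisymm (Nat.le_of_dvd M'.pos h) (Nat.le_of_dvd M.pos h'))

/-- **IUTchII:Prop1.5(i), the KILLED-TRANSITIONS twin** (kurims p. 29, "a projective system of mono-theta
environments `M^Θ_* = {… → M^Θ_{M'} → M^Θ_M → …}`"). Let `A` be ANY projective system over ANY model family
with one value `A.trans h x ≠ 1` of a transition at distinct indices `M ∣ M'`. Then there is a system `B`
with the SAME mono-theta environments (`B.env M = A.env M`, hence "isomorphic to the mod `M` model" exactly as
`A`'s) — and, by construction, the same Def. 1.1 (i) outputs — whose off-diagonal transitions are all TRIVIAL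
(the frozen interface carries `trans` as a bare continuous homomorphism, so the trivial homomorphism is
admissible: functorial, continuous, compatible with `Π_M ↠ Π_Y ⊆ Π_X`), and NO compatible family of
isomorphisms of mono-theta environments `A ≅ B` or `B ≅ A` exists: `¬ Prop15_i A B ∧ ¬ Prop15_i B A`.
This is the kernel witness asked for in the header of `MonoThetaProjectiveR.lean` (there: Kummer-shift twists;
here: no theta sections needed). [claim: Mochizuki2012, status: disputed] (IUTchII §1 Prop 1.5 (i), kurims p.29)
[cite: Mochizuki2012, Prop 1.5 (i) p.29] -/
theorem exists_twin_not_prop15_i (A : MonoThetaProjSystem F) {M₀ M₀' : ℕ+} (hne : M₀ ≠ M₀')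
    (h₀ : (M₀ : ℕ) ∣ (M₀' : ℕ)) (x₀ : (A.env M₀').Pi) (hx₀ : A.trans h₀ x₀ ≠ 1) :
    ∃ B : MonoThetaProjSystem F,
      (∀ M, B.env M = A.env M) ∧
      (∀ {M M' : ℕ+} (h : (M : ℕ) ∣ (M' : ℕ)), M ≠ M' → ∀ y : (B.env M').Pi, B.trans h y = 1) ∧
      ¬ Prop15_i A B ∧ ¬ Prop15_i B A := by
  classical
  -- the twin: same environments, same Def. 1.1 (i) outputs, transitions KILLED off the diagonal
  let B : MonoThetaProjSystem F :=
    { env := A.env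
      recon := A.recon
      trans := fun {M M'} h => if M = M' then A.trans h else 1
      trans_continuous := fun {M M'} h => by
        by_cases hM : M = M'
        · rw [if_pos hM]
          exact A.trans_continuous h
        · rw [if_neg hM]
          exact continuous_const
      trans_refl := fun M x => by
        rw [if_pos rfl]
        exact A.trans_refl M x
      trans_comp := fun {M M' M''} h h' x => by
        by_cases h1 : M = M'
        · subst h1
          by_cases h2 : M = M''
          · subst h2
            rw [if_pos rfl]
            exact A.trans_comp h h' x
          · simp only [if_neg h2, MonoidHom.one_apply, map_one]
        · have h3 : M ≠ M'' := fun h3 => h1 (pnat_eq_of_dvd_of_dvd_of_eq h h' h3)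
          simp only [if_neg h1, if_neg h3, MonoidHom.one_apply]
      transX := fun {M M'} h => if M = M' then A.transX h else 1
      transX_continuous := fun {M M'} h => by
        by_cases hM : M = M'
        · rw [if_pos hM]
          exact A.transX_continuous h
        · rw [if_neg hM]
          exact continuous_const
      transX_compat := fun {M M'} h x => by
        by_cases hM : M = M'
        · simp only [if_pos hM]
          exact A.transX_compat h x
        · simp only [if_neg hM, MonoidHom.one_apply, map_one] }
  have hkill : ∀ {M M' : ℕ+} (h : (M : ℕ) ∣ (M' : ℕ)), M ≠ M' → ∀ y : (B.env M').Pi, B.trans h y = 1 := by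
    intro M M' h hM y
    show (if M = M' then A.trans h else 1) y = 1
    rw [if_neg hM, MonoidHom.one_apply]
  have hAB : ¬ Prop15_i A B := by
    rintro ⟨e, he⟩
    apply hx₀
    have key := he h₀ x₀
    rw [hkill h₀ hne] at key
    exact (e M₀).iso.injective (key.trans (map_one (e M₀).iso).symm)
  exact ⟨B, fun _ => rfl, hkill, hAB, fun h => hAB (prop15_i_symm h)⟩

/-- **IUTchII:Def1.1(i) at level `M ≥ 2`** (kurims p. 21: "`Π_μ(M) := Ker(Π_M ↠ Π_Y(M))` … abstractly
isomorphic to `(ℤ/Nℤ)(1)`"): in a projective system the exterior cyclotome of the mod-`M` member is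
`≅ ℤ/Mℤ` (`Reconstruction.ext_iso_ZMod`; the setting `F.setting M` has `N = M`), so for `M ≥ 2` the group
`Π_{M^Θ_M}` has a non-trivial element inside `Π_μ(M^Θ_M)`. [claim: Mochizuki2012, status: disputed] (IUTchII §1 Def 1.1 (i), kurims p.21)
[cite: Mochizuki2012, Prop 1.5 (i) p.29] -/
theorem exists_extCyc_ne_one (A : MonoThetaProjSystem F) {M : ℕ+} (hM : 2 ≤ (M : ℕ)) :
    ∃ z : (A.env M).Pi, z ∈ (A.recon M).extCyc ∧ z ≠ 1 := by
  obtain ⟨e⟩ := (A.recon M).ext_iso_ZMod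
  have hN : ((F.setting M).N : ℕ) = M := rfl
  haveI : Fact (1 < ((F.setting M).N : ℕ)) := ⟨by rw [hN]; exact hM⟩
  refine ⟨((e.symm (Multiplicative.ofAdd 1) : (A.recon M).projY.ker) : (A.env M).Pi),
    (e.symm (Multiplicative.ofAdd 1)).2, fun h1 => ?_⟩
  have h2 : e.symm (Multiplicative.ofAdd 1) = 1 := Subtype.ext h1
  have h3 : Multiplicative.ofAdd (1 : ZMod ((F.setting M).N : ℕ)) = 1 :=
    e.symm.injective (h2.trans (map_one e.symm).symm)
  exact one_ne_zero (ofAdd_eq_one.mp h3)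

/-- **IUTchII:Prop1.5(i)** (kurims p. 29) Every projective system with SURJECTIVE transition maps — e.g. one whose
transitions are, up to isomorphisms of mono-theta environments, the model reductions
`Π^tp_{Y̲}[μ_{M'}] ↠ Π^tp_{Y̲}[μ_M]` — has a killed-transitions twin with the same environments which is NOT
compatibly isomorphic to it (indices `2 ∣ 4`; the target `Π_{M^Θ_2} ⊇ Π_μ ≅ ℤ/2` is non-trivial).
[claim: Mochizuki2012, status: disputed] (IUTchII §1 Prop 1.5 (i), kurims p.29) [cite: Mochizuki2012, Prop 1.5 (i) p.29] -/
theorem exists_twin_not_prop15_i_of_surjective (A : MonoThetaProjSystem F)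
    (hsurj : ∀ {M M' : ℕ+} (h : (M : ℕ) ∣ (M' : ℕ)), Function.Surjective (A.trans h)) :
    ∃ B : MonoThetaProjSystem F,
      (∀ M, B.env M = A.env M) ∧
      (∀ {M M' : ℕ+} (h : (M : ℕ) ∣ (M' : ℕ)), M ≠ M' → ∀ y : (B.env M').Pi, B.trans h y = 1) ∧
      ¬ Prop15_i A B ∧ ¬ Prop15_i B A := by
  have h24 : ((2 : ℕ+) : ℕ) ∣ ((4 : ℕ+) : ℕ) := ⟨2, rfl⟩
  obtain ⟨z, -, hz⟩ := A.exists_extCyc_ne_one (M := 2) le_rfl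
  obtain ⟨x, hx⟩ := hsurj h24 z
  exact A.exists_twin_not_prop15_i (by decide) h24 x (by rw [hx]; exact hz)

/-- **IUTchII:Prop1.5(i)** (kurims p. 29) — the frozen conclusion FAILS next to every GENUINE system: every
projective system OF MONO-THETA ENVIRONMENTS in the repaired sense of `MonoThetaProjectiveR.lean`
(`IsMonoThetaCompatible R`: each transition is the underlying map of a morphism of mono-theta environments,
[EtTh] Def. 2.13 (ii)) has a twin `B` with the same environments such that `¬ Prop15_i A B`, `¬ Prop15_i B A`;
the twin is NOT `R`-compatible (its transition `4 → 2` is trivial, not onto), so the REPAIRED statement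
`Prop15_i' R` holds for both orderings of the pair (vacuously) — the repair is immune to this witness, exactly
as its header asserts. [claim: Mochizuki2012, status: disputed] (IUTchII §1 Prop 1.5 (i), kurims p.29)
[cite: Mochizuki2012, Prop 1.5 (i) p.29] -/
theorem exists_twin_not_prop15_i_of_isMonoThetaCompatible (R : F.Reductions) (A : MonoThetaProjSystem F)
    (hA : A.IsMonoThetaCompatible R) :
    ∃ B : MonoThetaProjSystem F,
      (∀ M, B.env M = A.env M) ∧ ¬ Prop15_i A B ∧ ¬ Prop15_i B A ∧ ¬ B.IsMonoThetaCompatible R ∧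
        Prop15_i' R A B ∧ Prop15_i' R B A := by
  have h24 : ((2 : ℕ+) : ℕ) ∣ ((4 : ℕ+) : ℕ) := ⟨2, rfl⟩
  obtain ⟨B, henv, hkill, hAB, hBA⟩ := A.exists_twin_not_prop15_i_of_surjective
    (fun h => trans_surjective_of_isMonoThetaCompatible R A hA h)
  have hB : ¬ B.IsMonoThetaCompatible R := by
    intro hB
    obtain ⟨z, -, hz⟩ := B.exists_extCyc_ne_one (M := 2) le_rfl
    obtain ⟨y, hy⟩ := trans_surjective_of_isMonoThetaCompatible R B hB h24 z
    exact hz (hy.symm.trans (hkill h24 (by decide) y))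
  exact ⟨B, henv, hAB, hBA, hB, prop15_i'_of_not_compatible R (Or.inr hB),
    prop15_i'_of_not_compatible R (Or.inl hB)⟩

end MonoThetaProjSystem

/-! ## The closed certificate at the natural system of the Tate model -/

/-- **IUTchII:Prop1.5(i)** (kurims p. 29) There EXIST (universe `0`) a [IUTchII] §1 setting, a model family with
model reductions `R`, an `R`-COMPATIBLE projective system `A` (a system of mono-theta environments in print's
sense) and a second system `B` with the same environments, such that `¬ Prop15_i A B`, `¬ Prop15_i B A` and `B`
is not `R`-compatible. Witness: the NATURAL projective system of the Tate curve AT THE TATE MODEL (abc-iut-w5-d233's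
census `ThetaSetting.exists_isEtThOrigin_sec2Hyps_naturalSystem_of_dvd_pred` at `p = 13`, `l = 3`, chain
`EtaleLevels.chainSet 1 1` — its `IsMonoThetaCompatible` clause carries NO `Prop` binder) and its killed-transitions
twin. [claim: Mochizuki2012, status: disputed] (IUTchII §1 Prop 1.5 (i), kurims p.29) [cite: Mochizuki2012, Prop 1.5 (i) p.29] -/
theorem exists_isMonoThetaCompatible_twin_not_prop15_i :
    ∃ (S : ThetaSetting.{0}) (F : ModelFamily S) (R : F.Reductions) (A B : MonoThetaProjSystem F),
      A.IsMonoThetaCompatible R ∧ (∀ M, B.env M = A.env M) ∧ ¬ Prop15_i A B ∧ ¬ Prop15_i B A ∧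
        ¬ B.IsMonoThetaCompatible R := by
  haveI : Fact (Nat.Prime 13) := ⟨by norm_num⟩
  obtain ⟨D, hO, hS, hYcl, E, C, τ, h15, h15ii, L, hp2, hpl, hζ, f, hf, hslimX, -, hcompat, -⟩ :=
    ThetaSetting.exists_isEtThOrigin_sec2Hyps_naturalSystem_of_dvd_pred 13 3 (by decide) (by decide)
      (by decide) (EtaleLevels.one_mem_chainSet 1 1) (EtaleLevels.chainSet_cofinal 1 1)
      (EtaleLevels.chainSet_total (dvd_refl _))
  obtain ⟨B, henv, hAB, hBA, hB, -, -⟩ :=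
    MonoThetaProjSystem.exists_twin_not_prop15_i_of_isMonoThetaCompatible _ _ hcompat
  exact ⟨_, _, _, _, B, hcompat, henv, hAB, hBA, hB⟩

/-- **F-0665 is a schema** — **IUTchII:Prop1.5(i)** (kurims p. 29): the universal closure of the frozen
`Prop15_i` (over all [IUTchII] §1 settings, model families and PAIRS of projective systems with bare-homomorphism
transitions) is FALSE in the kernel; the instance forms the cone uses are `prop15_i_refl`,
`EtaleLevels.prop15_i_modelSystem_modelχ`, `ModelTateCarriers.prop15_i_i'_ii_iii_modelSystem_modelTate` (second
conjunct) and the repaired `Prop15_i'` (BY NAME). [claim: Mochizuki2012, status: disputed] (IUTchII §1 Prop 1.5 (i), kurims p.29)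
[cite: Mochizuki2012, Prop 1.5 (i) p.29] -/
theorem not_forall_prop15_i :
    ¬ ∀ (S : ThetaSetting.{0}) (F : ModelFamily S) (A B : MonoThetaProjSystem F), Prop15_i A B := by
  intro h
  obtain ⟨S, F, -, A, B, -, -, hAB, -⟩ := exists_isMonoThetaCompatible_twin_not_prop15_i
  exact hAB (h S F A B)

end Literature.IUT.HodgeArakelov
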